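import Literature.AlgebraicGeometry.Limits.LocalizationSpreadDedekind
import Literature.AlgebraicGeometry.Motives.IntegralModelReductionMap
import Literature.AlgebraicGeometry.Morphisms.ProjectiveMorphismComposition   -- ★ `IsProjective.pullback_snd` (ED. 2)
import HarnessLib

/-!
# Localisation of a GLOBAL integral model over `𝓞 F` at a prime `w`: an integral model over `𝒪_{F,(w)}`, smooth and proper
# at all but finitely many `w`, with the generic square of a localised morphism

Topic `Literature/AlgebraicGeometry/Motives`; namespace `Literature.AlgebraicGeometry.Motives.IntegralModel`.  Plumbing `def`s
(`towerLeftIso`, `towerIsoOver`, `localiseAt`, `localiseAtMap`, `localise`, `localiseMap`) and theorems; no named fact, no instance, no notation,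
no `sorry`.  Cell `hodgecm-mathlib`, P6 «MOD programme», organ (SP-F) = hand M-S (LEAD F0P6-plan (g0) M-2), statement-first sketch by
F0P6a-plan (g0) (`F0/P6/F0P6a-plan/sketch-SPF.v1.F0P6a-plan-g0.lean` 8eeb2a26): the sketch's API (`localise`, `localise_total`,
`eventually_isSmoothProper_localise`, `localiseMap`, `localiseMap_eq`, `genericFibre_map_localiseMap`) is kept NAME FOR NAME and STATEMENT FOR
STATEMENT; only the CONSTRUCTION of the generic isomorphism differs — the sketch's functor-level tower isomorphism (Mathlib `Over.pullbackComp`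
+ `overPullbackCongr`) makes the KERNEL time out on every downstream identity (the sketch's own warning; reproduced: even
`pullbackComp_symm_trans_congr_hom_app_left_comp_fst` applied at these functors is a kernel deterministic timeout), so the generic
isomorphism is built here on UNDERLYING SCHEMES from Mathlib's pasting isomorphism `pullbackLeftPullbackSndIso` + `pullback.congrHom`
and packaged with `Over.isoMk`; all identities are then proved by `pullback.hom_ext` against the two projections.  Consumer: PWCORE's
SPREAD step — the smooth proper models `𝒮c` of `M⋆_{Kc}` over `𝒪_{F,(w)}` for cofinitely many `w` are the localisations of ONE global model
over `𝓞 F` (spread of the projective generic fibre), and the `_hū`-type generic squares of the HLiu418 letters MODv3 ∕ PW are read on the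
localised morphisms.  HC_CM is proved only modulo the printed citations until rung 0 closes; nothing here is about HC.

THE MATHEMATICS.  A global model of an `F`-scheme `X` is `IntegralModel (𝓞 F) F X` (★ `Motives/GoodReduction`: an `𝓞 F`-scheme `𝒳` with
`𝒳 ⊗_{𝓞 F} F ≅ X`; [SerreTate1968] §1).  For a tower of rings `A → R → K` (`Spec K → Spec R → Spec A`) and an `A`-scheme `𝒲`, transitivity
of fibre products gives `(𝒲 ×_A R) ×_R K ≅ 𝒲 ×_A K` over `K`, compatible with the projections to `𝒲` ([GortzWedhorn2020] Prop. 4.16,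
§(4.8)); so a model over `A` LOCALISES to a model over `R` of the same generic fibre (`localiseAt`; [SerreTate1968] §1 «model over
`𝒪_(v)`»), a morphism of models localises (`localiseAtMap`) and covers the same morphism of generic fibres
(`baseChange_map_localiseAtMap_comp_genericIso_hom`).  At `A = 𝓞 F`, `R = 𝒪_{F,(w)}`, `K = F`, the ★ cofinite spreading theorem
`Limits.LocApprox.eventually_smoothOfRelativeDimension_isProper_flat_atPrime_of_iso` ([EGAIV3] 8.10.5, [EGAIV4] 17.7.8; [StacksProject]
Tags 081F, 0C0C) makes the localisation of a finitely presented global model with smooth proper generic fibre of relative dimension `n`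
smooth and proper of relative dimension `n` for all but finitely many `w`.

MAIN STATEMENTS.  §1 (tower `A → R → K`): `specMap_algebraMap_comp`, `towerLeftIso` (def) + `towerLeftIso_hom_fst`∕`_snd`, `towerIsoOver`
(def) + `towerIsoOver_hom_left`, `baseChange_obj_hom`, `baseChange_map_left_comp_fst`, **`localiseAt`** (def), `localiseAt_total`,
`localiseAt_genericIso_hom`, `localiseAt_genericIso_hom_left_comp_fst`, `localiseAtMap` (def), **`baseChange_map_localiseAtMap_comp_genericIso_hom`**;
§2 (number fields): **`localise`** (def), `localise_total`, `localise_eq_localiseAt`, **`eventually_isSmoothProper_localise`**, `localiseMap` (def),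
`localiseMap_eq`, **`genericFibre_map_localiseMap`**.

## References
* [SerreTate1968] J.-P. Serre, J. Tate, *Good reduction of abelian varieties*, Ann. of Math. 88 (1968), §1 (models over `𝒪_(v)`).
* [GortzWedhorn2020] U. Görtz, T. Wedhorn, *Algebraic Geometry I* (2nd ed.), Prop. 4.16 and §(4.7)–(4.8) (transitivity of fibre products).
* [StacksProject] The Stacks Project, Tags 081F, 0C0C (spreading out smoothness ∕ properness over a cofinite set of primes).
-/

set_option autoImplicit false

noncomputable section

set_option backward.isDefEq.respectTransparency false

open CategoryTheory CategoryTheory.Limits AlgebraicGeometry IsDedekindDomain IsDedekindDomain.HeightOneSpectrum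
open scoped NumberField
open Literature.NumberTheory.EllipticCurves (genericFibre)

namespace Literature.AlgebraicGeometry.Motives.IntegralModel

/-! ## §1 A tower of rings `A → R → K`: localisation of models over `A` to models over `R` -/

section Tower

variable {A R K : Type} [CommRing A] [CommRing R] [Field K] [Algebra A R] [Algebra R K] [Algebra A K]
  [IsScalarTower A R K]

/-- `Spec K → Spec R → Spec A` is `Spec K → Spec A` (the tower `A → R → K`). [cite: GortzWedhorn2020, Prop. 4.16 and §(4.8)] -/
theorem specMap_algebraMap_comp :
    Spec.map (CommRingCat.ofHom (algebraMap R K)) ≫ Spec.map (CommRingCat.ofHom (algebraMap A R)) =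
      Spec.map (CommRingCat.ofHom (algebraMap A K)) := by
  rw [← Spec.map_comp, ← CommRingCat.ofHom_comp, ← IsScalarTower.algebraMap_eq]

/-- **Transitivity of fibre products on underlying schemes: `(𝒲 ×_A R) ×_R K ≅ 𝒲 ×_A K`** (Mathlib's pasting isomorphism
`pullbackLeftPullbackSndIso` followed by `pullback.congrHom` along `Spec K → Spec R → Spec A = Spec K → Spec A`).
[cite: GortzWedhorn2020, Prop. 4.16 and §(4.8)] -/
def towerLeftIso (𝒲 : SchemeOver A) :
    ((baseChange R K).obj ((baseChange A R).obj 𝒲)).left ≅ ((baseChange A K).obj 𝒲).left :=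
  pullbackLeftPullbackSndIso 𝒲.hom (Spec.map (CommRingCat.ofHom (algebraMap A R)))
      (Spec.map (CommRingCat.ofHom (algebraMap R K))) ≪≫
    pullback.congrHom rfl (specMap_algebraMap_comp (A := A) (R := R) (K := K))

/-- `towerLeftIso` against the first projections: `e ≫ pr_𝒲 = pr_{𝒲 ⊗ R} ≫ pr_𝒲`. [cite: GortzWedhorn2020, Prop. 4.16 and §(4.8)] -/
@[reassoc]
theorem towerLeftIso_hom_fst (𝒲 : SchemeOver A) :
    (towerLeftIso (R := R) (K := K) 𝒲).hom ≫ pullback.fst 𝒲.hom (Spec.map (CommRingCat.ofHom (algebraMap A K))) =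
      pullback.fst (pullback.snd 𝒲.hom (Spec.map (CommRingCat.ofHom (algebraMap A R))))
          (Spec.map (CommRingCat.ofHom (algebraMap R K))) ≫
        pullback.fst 𝒲.hom (Spec.map (CommRingCat.ofHom (algebraMap A R))) := by
  simp [towerLeftIso]

/-- `towerLeftIso` against the second projections: `e ≫ pr_{Spec K} = pr_{Spec K}`. [cite: GortzWedhorn2020, Prop. 4.16 and §(4.8)] -/
@[reassoc]
theorem towerLeftIso_hom_snd (𝒲 : SchemeOver A) :
    (towerLeftIso (R := R) (K := K) 𝒲).hom ≫ pullback.snd 𝒲.hom (Spec.map (CommRingCat.ofHom (algebraMap A K))) =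
      pullback.snd (pullback.snd 𝒲.hom (Spec.map (CommRingCat.ofHom (algebraMap A R))))
        (Spec.map (CommRingCat.ofHom (algebraMap R K))) := by
  simp [towerLeftIso]

/-- **The tower isomorphism OVER `Spec K`**: `(𝒲 ⊗_A R) ⊗_R K ≅ 𝒲 ⊗_A K` as `K`-schemes (`Over.isoMk` of `towerLeftIso`).
[cite: GortzWedhorn2020, Prop. 4.16 and §(4.8)] -/
def towerIsoOver (𝒲 : SchemeOver A) :
    (baseChange R K).obj ((baseChange A R).obj 𝒲) ≅ (baseChange A K).obj 𝒲 :=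
  Over.isoMk (towerLeftIso 𝒲) (towerLeftIso_hom_snd 𝒲)

/-- The underlying isomorphism of `towerIsoOver` is `towerLeftIso` (by `rfl`). [cite: GortzWedhorn2020, Prop. 4.16 and §(4.8)] -/
theorem towerIsoOver_hom_left (𝒲 : SchemeOver A) : (towerIsoOver (R := R) (K := K) 𝒲).hom.left = (towerLeftIso 𝒲).hom := rfl

omit [Algebra R K] [Algebra A K] [IsScalarTower A R K] in
/-- The structure map of `𝒲 ⊗_A R` is the second projection (by `rfl`). [cite: GortzWedhorn2020, §(4.8)] -/
theorem baseChange_obj_hom (𝒲 : SchemeOver A) :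
    ((baseChange A R).obj 𝒲).hom = pullback.snd 𝒲.hom (Spec.map (CommRingCat.ofHom (algebraMap A R))) := rfl

omit [Algebra R K] [Algebra A K] [IsScalarTower A R K] in
/-- `(U ⊗_A R) ≫ pr = pr ≫ U` on underlying schemes (naturality of the first projection; Mathlib `pullback.lift_fst`).
[cite: GortzWedhorn2020, §(4.8)] -/
@[reassoc]
theorem baseChange_map_left_comp_fst {𝒲 𝒲' : SchemeOver A} (U : 𝒲 ⟶ 𝒲') :
    ((baseChange A R).map U).left ≫ pullback.fst 𝒲'.hom (Spec.map (CommRingCat.ofHom (algebraMap A R))) =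
      pullback.fst 𝒲.hom (Spec.map (CommRingCat.ofHom (algebraMap A R))) ≫ U.left :=
  pullback.lift_fst _ _ _

variable {X Y : SchemeOver K}

/-- **Localisation of an integral model along `A → R`** ([SerreTate1968] §1: a model over a ring of `S`-integers gives a model over each
`𝒪_(v)`): `𝒳 ⊗_A R` with generic isomorphism the tower isomorphism followed by `𝒳.genericIso`. [cite: SerreTate1968, §1] -/
def localiseAt (𝒳 : IntegralModel A K X) (R : Type) [CommRing R] [Algebra A R] [Algebra R K] [IsScalarTower A R K] :
    IntegralModel R K X where
  total := (baseChange A R).obj 𝒳.total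
  genericIso := towerIsoOver 𝒳.total ≪≫ 𝒳.genericIso

/-- The total space of the localised model is `𝒳 ⊗_A R` (by `rfl`). [cite: SerreTate1968, §1] -/
@[simp] theorem localiseAt_total (𝒳 : IntegralModel A K X) :
    (𝒳.localiseAt R).total = (baseChange A R).obj 𝒳.total := rfl

/-- Unfolding the generic isomorphism of the localised model. [cite: SerreTate1968, §1] -/
theorem localiseAt_genericIso_hom (𝒳 : IntegralModel A K X) :
    (𝒳.localiseAt R).genericIso.hom = (towerIsoOver 𝒳.total).hom ≫ 𝒳.genericIso.hom := rfl

/-- **The generic isomorphism of `𝒳 ⊗_A R` over the projections to `𝒳`**: `genericIso′ ≫ genericIso⁻¹ ≫ pr_𝒳 = pr_{𝒳 ⊗ R} ≫ pr_𝒳` on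
underlying schemes. [cite: GortzWedhorn2020, Prop. 4.16 and §(4.8)] [cite: SerreTate1968, §1] -/
theorem localiseAt_genericIso_hom_left_comp_fst (𝒳 : IntegralModel A K X) :
    (𝒳.localiseAt R).genericIso.hom.left ≫ 𝒳.genericIso.inv.left ≫
        pullback.fst 𝒳.total.hom (Spec.map (CommRingCat.ofHom (algebraMap A K))) =
      pullback.fst (pullback.snd 𝒳.total.hom (Spec.map (CommRingCat.ofHom (algebraMap A R))))
          (Spec.map (CommRingCat.ofHom (algebraMap R K))) ≫
        pullback.fst 𝒳.total.hom (Spec.map (CommRingCat.ofHom (algebraMap A R))) := by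
  have h : 𝒳.genericIso.hom.left ≫ 𝒳.genericIso.inv.left = 𝟙 _ := by
    rw [← Over.comp_left, Iso.hom_inv_id, Over.id_left]
  rw [localiseAt_genericIso_hom, Over.comp_left, Category.assoc, reassoc_of% h, towerIsoOver_hom_left, towerLeftIso_hom_fst]

/-- The localisation along `A → R` of a morphism of models over `A`. [cite: SerreTate1968, §1] -/
def localiseAtMap (𝒳 : IntegralModel A K X) (𝒴 : IntegralModel A K Y) (U : 𝒳.total ⟶ 𝒴.total)
    (R : Type) [CommRing R] [Algebra A R] [Algebra R K] [IsScalarTower A R K] :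
    (𝒳.localiseAt R).total ⟶ (𝒴.localiseAt R).total :=
  (baseChange A R).map U

/-- Unfolding `localiseAtMap`. [cite: SerreTate1968, §1] -/
theorem localiseAtMap_eq (𝒳 : IntegralModel A K X) (𝒴 : IntegralModel A K Y) (U : 𝒳.total ⟶ 𝒴.total) :
    localiseAtMap 𝒳 𝒴 U R = (baseChange A R).map U := rfl

/-- **Generic square of the localised morphism**: if `U : 𝒳 → 𝒴` covers `u : X ⟶ Y` on generic fibres through the models' generic
isomorphisms, then so does `U ⊗_A R` through the localised models' generic isomorphisms.  Proof on UNDERLYING schemes: rewrite with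
`hU`, cancel `𝒴.genericIso`, then `pullback.hom_ext` into `𝒴 ⊗_A K` — first projections by `towerLeftIso_hom_fst` and
`baseChange_map_left_comp_fst`, second projections by `towerLeftIso_hom_snd` and `Over.w`.
[cite: GortzWedhorn2020, Prop. 4.16 and §(4.8)] [cite: SerreTate1968, §1] -/
theorem baseChange_map_localiseAtMap_comp_genericIso_hom (𝒳 : IntegralModel A K X) (𝒴 : IntegralModel A K Y)
    (U : 𝒳.total ⟶ 𝒴.total) (u : X ⟶ Y) (hU : (baseChange A K).map U ≫ 𝒴.genericIso.hom = 𝒳.genericIso.hom ≫ u) :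
    (baseChange R K).map (localiseAtMap 𝒳 𝒴 U R) ≫ (𝒴.localiseAt R).genericIso.hom = (𝒳.localiseAt R).genericIso.hom ≫ u := by
  rw [localiseAt_genericIso_hom, localiseAt_genericIso_hom, Category.assoc, ← hU, localiseAtMap_eq]
  simp only [← Category.assoc]
  congr 1
  apply Over.OverMorphism.ext
  rw [Over.comp_left, Over.comp_left, towerIsoOver_hom_left, towerIsoOver_hom_left]
  -- the projection laws of the three base-changed morphisms, in the unfolded currency of `pullback.hom_ext`
  have f0 : ((baseChange A R).map U).left ≫ pullback.fst 𝒴.total.hom (Spec.map (CommRingCat.ofHom (algebraMap A R))) =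
      pullback.fst 𝒳.total.hom (Spec.map (CommRingCat.ofHom (algebraMap A R))) ≫ U.left :=
    pullback.lift_fst _ _ _
  have f1 : ((baseChange R K).map ((baseChange A R).map U)).left ≫
        pullback.fst (pullback.snd 𝒴.total.hom (Spec.map (CommRingCat.ofHom (algebraMap A R))))
          (Spec.map (CommRingCat.ofHom (algebraMap R K))) =
      pullback.fst (pullback.snd 𝒳.total.hom (Spec.map (CommRingCat.ofHom (algebraMap A R))))
          (Spec.map (CommRingCat.ofHom (algebraMap R K))) ≫ ((baseChange A R).map U).left :=
    pullback.lift_fst _ _ _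
  have f2 : ((baseChange A K).map U).left ≫ pullback.fst 𝒴.total.hom (Spec.map (CommRingCat.ofHom (algebraMap A K))) =
      pullback.fst 𝒳.total.hom (Spec.map (CommRingCat.ofHom (algebraMap A K))) ≫ U.left :=
    pullback.lift_fst _ _ _
  have e1 : ((baseChange R K).map ((baseChange A R).map U)).left ≫
        pullback.snd (pullback.snd 𝒴.total.hom (Spec.map (CommRingCat.ofHom (algebraMap A R))))
          (Spec.map (CommRingCat.ofHom (algebraMap R K))) =
      pullback.snd (pullback.snd 𝒳.total.hom (Spec.map (CommRingCat.ofHom (algebraMap A R))))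
          (Spec.map (CommRingCat.ofHom (algebraMap R K))) :=
    Over.w _
  have e2 : ((baseChange A K).map U).left ≫ pullback.snd 𝒴.total.hom (Spec.map (CommRingCat.ofHom (algebraMap A K))) =
      pullback.snd 𝒳.total.hom (Spec.map (CommRingCat.ofHom (algebraMap A K))) :=
    Over.w _
  apply pullback.hom_ext
  · rw [Category.assoc, Category.assoc, towerLeftIso_hom_fst, f2, towerLeftIso_hom_fst_assoc, reassoc_of% f1, f0]
  · rw [Category.assoc, Category.assoc, towerLeftIso_hom_snd, e1, e2, towerLeftIso_hom_snd]

end Tower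

/-! ## §2 Number fields: localisation of a global model over `𝓞 F` at a prime `w` -/

section NumberField

variable {F : Type} [Field F] [NumberField F] {X Y : SchemeOver F}

/-- **Localisation at `w` of a global integral model** (`localiseAt` along `𝓞 F → 𝒪_{F,(w)}`): `𝒳 ⊗_{𝓞 F} 𝒪_{F,(w)}` with generic
isomorphism the tower isomorphism followed by `𝒳.genericIso`. [cite: SerreTate1968, §1] -/
def localise (𝒳 : IntegralModel (𝓞 F) F X) (w : HeightOneSpectrum (𝓞 F)) :
    IntegralModel (valuationSubringAtPrime F w) F X :=
  𝒳.localiseAt (valuationSubringAtPrime F w)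

/-- `localise = localiseAt` (by `rfl`). [cite: SerreTate1968, §1] -/
theorem localise_eq_localiseAt (𝒳 : IntegralModel (𝓞 F) F X) (w : HeightOneSpectrum (𝓞 F)) :
    𝒳.localise w = 𝒳.localiseAt (valuationSubringAtPrime F w) := rfl

/-- The total space of the localised model is `𝒳 ⊗_{𝓞 F} 𝒪_(w)` (by `rfl`). [cite: SerreTate1968, §1] -/
@[simp] theorem localise_total (𝒳 : IntegralModel (𝓞 F) F X) (w : HeightOneSpectrum (𝓞 F)) :
    (𝒳.localise w).total = (baseChange (𝓞 F) (valuationSubringAtPrime F w)).obj 𝒳.total := rfl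

/-- **A global model of finite presentation with smooth proper generic fibre of relative dimension `n` is smooth and proper of
relative dimension `n` at all but finitely many primes** (★ `Limits.LocApprox.eventually_smoothOfRelativeDimension_isProper_flat_atPrime_of_iso`
at `T := 𝒪_{F,(w)}`). [cite: StacksProject, Tags 081F, 0C0C] -/
theorem eventually_isSmoothProper_localise {n : ℕ} (𝒳 : IntegralModel (𝓞 F) F X)
    [QuasiCompact 𝒳.total.hom] [QuasiSeparated 𝒳.total.hom] [LocallyOfFinitePresentation 𝒳.total.hom]
    (hXn : SmoothOfRelativeDimension n X.hom) (hXpr : IsProper X.hom) :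
    ∀ᶠ w : HeightOneSpectrum (𝓞 F) in Filter.cofinite, (𝒳.localise w).IsSmoothProper n := by
  filter_upwards [Limits.LocApprox.eventually_smoothOfRelativeDimension_isProper_flat_atPrime_of_iso F
    𝒳.total hXn hXpr 𝒳.genericIso] with w hw
  obtain ⟨h1, h2, -⟩ := hw (valuationSubringAtPrime F w)
  exact ⟨h1, h2⟩

/-- The localisation at `w` of a morphism of global models. [cite: SerreTate1968, §1] -/
def localiseMap (𝒳 : IntegralModel (𝓞 F) F X) (𝒴 : IntegralModel (𝓞 F) F Y) (U : 𝒳.total ⟶ 𝒴.total)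
    (w : HeightOneSpectrum (𝓞 F)) : (𝒳.localise w).total ⟶ (𝒴.localise w).total :=
  localiseAtMap 𝒳 𝒴 U (valuationSubringAtPrime F w)

/-- Unfolding `localiseMap`. [cite: SerreTate1968, §1] -/
theorem localiseMap_eq (𝒳 : IntegralModel (𝓞 F) F X) (𝒴 : IntegralModel (𝓞 F) F Y) (U : 𝒳.total ⟶ 𝒴.total)
    (w : HeightOneSpectrum (𝓞 F)) :
    localiseMap 𝒳 𝒴 U w = (baseChange (𝓞 F) (valuationSubringAtPrime F w)).map U := rfl

/-- **Generic square of the localised morphism** (the sketch's one obligation): if `U : 𝒳 → 𝒴` covers `u : X ⟶ Y` on generic fibres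
(through the models' generic isomorphisms) then so does its localisation at `w` — in the `genericFibre`∕`genericIso'` currency of
`IntegralModelReductionMap` (= the `_hū` hypothesis of the HLiu418 letters MODv3 ∕ PW); `genericFibre 𝒪_(w) F = baseChange 𝒪_(w) F` and
`genericIso' = genericIso` by `rfl`. [cite: GortzWedhorn2020, Prop. 4.16 and §(4.8)] [cite: SerreTate1968, §1] -/
theorem genericFibre_map_localiseMap (𝒳 : IntegralModel (𝓞 F) F X) (𝒴 : IntegralModel (𝓞 F) F Y)
    (U : 𝒳.total ⟶ 𝒴.total) (u : X ⟶ Y)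
    (hU : (baseChange (𝓞 F) F).map U ≫ 𝒴.genericIso.hom = 𝒳.genericIso.hom ≫ u)
    (w : HeightOneSpectrum (𝓞 F)) :
    (genericFibre (valuationSubringAtPrime F w) F).map (localiseMap 𝒳 𝒴 U w) ≫ (𝒴.localise w).genericIso'.hom =
      (𝒳.localise w).genericIso'.hom ≫ u :=
  baseChange_map_localiseAtMap_comp_genericIso_hom 𝒳 𝒴 U u hU

end NumberField

/-! ## §3 ED. 2 — projectivity localises (the «UP a PROJECTIVE `𝓨` over `Spec 𝒪_{F,(w)}`» input of hand M-A's `_hcovθ`) -/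

section Projective

variable {A R K : Type} [CommRing A] [CommRing R] [Field K] [Algebra A R] [Algebra R K] [Algebra A K]
  [IsScalarTower A R K] {X : SchemeOver K}

/-- **Projectivity localises**: if the total space of a model is projective over `Spec A` (a closed subscheme of some `ℙⁿ_A`), so is
its localisation over `Spec R` (base change of the closed immersion; ★ `Morphisms.IsProjective.pullback_snd`).
[cite: GortzWedhorn2020, Prop. 4.16 and §(4.8)] [cite: Hartshorne1977, II §4 Definition p.103 (projective morphism)] -/
theorem isProjective_localiseAt_total_hom (𝒳 : IntegralModel A K X) (h : Morphisms.IsProjective 𝒳.total.hom) :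
    Morphisms.IsProjective (𝒳.localiseAt R).total.hom :=
  h.pullback_snd _

end Projective

section ProjectiveNumberField

variable {F : Type} [Field F] [NumberField F] {X : SchemeOver F}

/-- **Projectivity localises at `w`**: a global model projective over `Spec 𝓞 F` localises to a model projective over `Spec 𝒪_{F,(w)}`
(so every finite set of its points lies in an affine open, and finite-group quotients ∕ `_hcov`-type hypotheses are available — ★
`RelativeSpec/StableAffineOpenProjectiveOverAffine`). [cite: GortzWedhorn2020, Prop. 4.16 and §(4.8)]
[cite: Hartshorne1977, II §4 Definition p.103 (projective morphism)] -/
theorem isProjective_localise_total_hom (𝒳 : IntegralModel (𝓞 F) F X) (w : HeightOneSpectrum (𝓞 F))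
    (h : Morphisms.IsProjective 𝒳.total.hom) : Morphisms.IsProjective (𝒳.localise w).total.hom :=
  h.pullback_snd _

end ProjectiveNumberField

end Literature.AlgebraicGeometry.Motives.IntegralModel
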